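import Literature.Computability.AlgebraicComplexity.PerDetObstructionKinds
import Literature.Computability.AlgebraicComplexity.OrbitMultiplicitySemigroup
import Literature.Computability.AlgebraicComplexity.MultiplicityObstructionsProofs
import Literature.Computability.Complexity.OccurrenceObstructionsDischarge
import Literature.Computability.AlgebraicComplexity.OccurrenceObstructionWeights
import HarnessLib

/-!
# Kinds of multiplicity obstructions for `det_m` versus the fresh-variable padded permanent:
# what Bürgisser–Ikenmeyer–Panova's theorem leaves, unconditionally

Topic `Literature/Computability/AlgebraicComplexity`; proofs file (theorems only, no definitions, no
named facts), companion of `PerDetObstructionKinds.lean` (certificate shapes deciding the KIND of an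
obstruction for the pair (`detFormLex k m`, `paddedPerFormLex k n m`)), of
`PerDetMultiplicityObstruction.lean` (`PerDetMultiplicityObstruction n m χ`: `n ≤ m` and
`mult_χ k[Δ(det_m)] < mult_χ k[Δ(X₀₀^{m-n} per_n)]`, the hypothesis shape of every dc-language
consequence in the tree) and of `ObstructionTypes.lean` (the typology
`IsOccurrenceObstructionAt` / `IsVanishingIdealOccurrenceObstructionAt` /
`IsPureMultiplicityObstructionAt` and its trichotomy).

Letters: `n` = permanent size, `m` = determinant size (cell coordinates of
`PerDetMultiplicityObstruction.lean`); the padded permanent is the tree's FRESH-VARIABLE padding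
`paddedPerFormLex ℂ n m = X₀₀^{m-n} · per_n(bottom-right block)` (`X₀₀` not a variable of `per_n`),
the convention of `PerDetMultiplicityObstruction`, of route `ValiantsHypothesis/GCTMult`
(`GctMultFlip`, `GctNoMultBarrier`) and of `Summits/PneNP/GCT/SufficesForValiant.lean`.

## What is proved

Bürgisser–Ikenmeyer–Panova (J. AMS 32 (2019) = arXiv:1604.06431v3), Thm. 1.4: "Let `n, d, m` be
positive integers with `n ≥ m^25` and `λ ⊢ nd`. If `λ` occurs in `ℂ[Z_{n,m}]`, then `λ` also occurs
in `ℂ[Ω_n]`. In particular, Conjecture 1.3 is false." The printed `Z_{n,m}` pads with a variable OF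
the permanent; BIP's proof (§6) run with their parameter `m := m + 1` gives the same conclusion for
the fresh-variable padding at threshold `(m+1)^25` (their letters), which the tree PROVES as
`Literature.Computability.Complexity.no_occurrence_obstructions_succ_holds`
(`OccurrenceObstructionsDischarge.lean`; weight form, `HasHighestWeight`). This file turns that
theorem into the numeric `orbitMultiplicity` letters of the three files above (occurrence =
positive multiplicity, `orbitMultiplicity_pos_iff_hasHighestWeight`, `OrbitMultiplicitySemigroup.lean`):

* `orbitMultiplicity_det_pos_of_paddedPer_pos` — for `(n+1)^25 ≤ m`:
  `0 < mult_χ ℂ[Δ(X₀₀^{m-n} per_n)] → 0 < mult_χ ℂ[Δ(det_m)]`; equivalently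
  `min 1 (mult_χ per-side) ≤ min 1 (mult_χ det-side)` (`min_one_orbitMultiplicity_paddedPer_le_det`:
  the OCCURRENCE SHADOW of the open "no multiplicity flip" statement `GctNoMultBarrier` of route
  `ValiantsHypothesis/GCTMult`, which asks the same WITHOUT `min 1`);
* `not_isOccurrenceObstructionAt_perDet_of_succ_pow_le` — no `χ` is an occurrence obstruction
  against `X₀₀^{m-n} per_n ∈ Δ(det_m)` once `(n+1)^25 ≤ m` (the fresh-padding twin of
  `ObstructionTypes.not_isOccurrenceObstructionAt_det_of_bip2019`, BIP's own padding, `n^25 ≤ m`);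
* `PerDetMultiplicityObstruction.orbitMultiplicity_det_pos`, `.two_le_orbitMultiplicity_paddedPer`,
  `.not_isOccurrenceObstructionAt`, `.isVanishingIdealOccurrence_or_pure` — an obstruction at
  `(n, m)` with `(n+1)^25 ≤ m`, should one exist (OPEN for every `m > n ≥ 3`, Bläser–Ikenmeyer 2025
  §12.4), is a GENUINE flip `1 ≤ mult_det < mult_per` (so `mult_per ≥ 2`), of the vanishing-ideal
  or of the pure kind (trichotomy of `ObstructionTypes.lean` with BLMW's bound
  `orbitMultiplicity_le_plethysmCoeff_holds`), never an occurrence obstruction;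
* (append, t01) `PerDetMultiplicityObstruction.exists_hasMultiplicityObstruction` — a numeric flip
  IS a module-form multiplicity obstruction: in characteristic zero, `PerDetMultiplicityObstruction n m χ`
  gives a degree `d` with `|χ| = -m·d` and `HasMultiplicityObstruction (detPoly (Fin m) k) (paddedPerPoly k n m) m d`
  (no surjective `GL_{m²}`-intertwiner `k[Δ(det_m)]_d ↠ k[Δ(X₀₀^{m-n} per_n)]_d`; the shape of the crux
  `GctMultObstructions` of route `ValiantsHypothesis/GCTMult`), via
  `exists_hasMultiplicityObstruction_of_isMultiplicityObstructionAt` (`OccurrenceObstructionWeights.lean`)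
  and transport along `toLex`;
* polynomial threshold: for `2 ≤ n` the hypothesis `n ^ 50 ≤ m` suffices (`(n+1)^25 ≤ n^50`,
  `succ_pow_le_of_pow_fifty_le`), the shape `n ^ c₀ ≤ m` of `GctNoMultBarrier`.

Honest framing (cell `val-lit`, rung V3): typed links over PROVED tree theorems; the existence of any
multiplicity obstruction for `(per_n, det_m)`, `m > n ≥ 3`, is open; nothing here bears on VP ≠ VNP.

## References

* P. Bürgisser, C. Ikenmeyer, G. Panova, *No occurrence obstructions in geometric complexity
  theory*, J. Amer. Math. Soc. 32 (2019) 163–193 = arXiv:1604.06431v3, Thm. 1.4, §1.4 ("there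
  still remains the possibility that one may succeed so by comparing multiplicities") and §6
  (Proof of Theorem 1.4). [BurgisserIkenmeyerPanovaJAMS2019]
* J. Dörfler, C. Ikenmeyer, G. Panova, SIAM J. Appl. Algebra Geom. 4 (2020) = arXiv:1901.04576, §2
  (occurrence vs multiplicity obstructions). [DorflerIkenmeyerPanova2020]
* C. Ikenmeyer, U. Kandasamy, STOC 2020 = arXiv:1911.03990, §2 and Prop. 5.3 (vanishing ideal
  occurrence / pure multiplicity obstructions). [IkenmeyerKandasamy2019]
* M. Bläser, C. Ikenmeyer, Theory of Computing Graduate Surveys 10 (2025), §12.4. [BlaeserIkenmeyer2025]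

## Mathlib and tree

Tree: `Literature.Computability.Complexity.no_occurrence_obstructions_succ_holds`
(`OccurrenceObstructionsDischarge.lean`), `orbitMultiplicity_pos_iff_hasHighestWeight`
(`OrbitMultiplicitySemigroup.lean`), `orbitMultiplicity_le_plethysmCoeff_holds`
(`MultiplicityObstructionsProofs.lean`), `isMultiplicityObstructionAt_trichotomy_of_isHomogeneous`
(`ObstructionTypes.lean`), `perDetMultiplicityObstruction_iff` (`PerDetMultiplicityObstruction.lean`),
`paddedPerOrbitRep`, `detOrbitRep`, `paddedPerFormLex_isHomogeneous` (`SchurWeylPlethysm.lean`).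
-/

namespace Literature.Computability.AlgebraicComplexity

open _root_.Literature.NumberTheory.DiophantineGeometry

/-! ### 1. BIP Thm. 1.4 for the fresh-variable padding, in multiplicity letters -/

/-- **Bürgisser–Ikenmeyer–Panova Thm. 1.4, fresh-variable padding, multiplicity letters.** For
`(n+1)^25 ≤ m`: if the highest weight `χ` of `GL_{m²}` has positive multiplicity in
`ℂ[Δ(X₀₀^{m-n} per_n)]` (fresh padding variable), then it has positive multiplicity in `ℂ[Δ(det_m)]`.
This is the tree's PROVED weight-form statement
`Literature.Computability.Complexity.no_occurrence_obstructions_succ_holds` (BIP §6 run with their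
parameter `m := m + 1`) read through `orbitMultiplicity_pos_iff_hasHighestWeight`.
[cite: BurgisserIkenmeyerPanovaJAMS2019, Thm. 1.4 and §6 (Proof of Theorem 1.4)] -/
theorem orbitMultiplicity_det_pos_of_paddedPer_pos {n m : ℕ} [NeZero m] (hnm : (n + 1) ^ 25 ≤ m)
    {χ : Weight (MatIdx m)} (h : 0 < orbitMultiplicity ℂ (paddedPerFormLex ℂ n m) m χ) :
    0 < orbitMultiplicity ℂ (detFormLex ℂ m) m χ := by
  have hper : HasHighestWeight (paddedPerOrbitRep ℂ n m) χ :=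
    (orbitMultiplicity_pos_iff_hasHighestWeight (paddedPerFormLex ℂ n m) (NeZero.ne m) χ).1 h
  have hdet : HasHighestWeight (detOrbitRep ℂ m) χ :=
    Complexity.no_occurrence_obstructions_succ_holds n m hnm χ hper
  exact (orbitMultiplicity_pos_iff_hasHighestWeight (detFormLex ℂ m) (NeZero.ne m) χ).2 hdet

/-- **The occurrence shadow of "no multiplicity flip"**: for `(n+1)^25 ≤ m` and every highest
weight `χ`, `min 1 (mult_χ ℂ[Δ(X₀₀^{m-n} per_n)]) ≤ min 1 (mult_χ ℂ[Δ(det_m)])`. Route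
`ValiantsHypothesis/GCTMult` files the same inequality WITHOUT the truncation `min 1` as its open kill
criterion `GctNoMultBarrier` ("the multiplicity analogue of the BIP no-occurrence theorem", not
known); the truncated form is exactly BIP Thm. 1.4. [cite: BurgisserIkenmeyerPanovaJAMS2019, Thm. 1.4] -/
theorem min_one_orbitMultiplicity_paddedPer_le_det {n m : ℕ} [NeZero m] (hnm : (n + 1) ^ 25 ≤ m)
    (χ : Weight (MatIdx m)) :
    min 1 (orbitMultiplicity ℂ (paddedPerFormLex ℂ n m) m χ) ≤
      min 1 (orbitMultiplicity ℂ (detFormLex ℂ m) m χ) := by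
  rcases Nat.eq_zero_or_pos (orbitMultiplicity ℂ (paddedPerFormLex ℂ n m) m χ) with h0 | hpos
  · rw [h0]
    exact (Nat.min_eq_right (Nat.zero_le 1)).le.trans (Nat.zero_le _)
  · have hdet := orbitMultiplicity_det_pos_of_paddedPer_pos hnm hpos
    omega

/-- **No occurrence obstructions for the fresh-variable padding** (numeric typology of
`ObstructionTypes.lean`): for `(n+1)^25 ≤ m` no highest weight `χ` of `GL_{m²}` is an occurrence
obstruction against `X₀₀^{m-n} per_n ∈ Δ(det_m)`, i.e. `mult_χ ℂ[Δ(det_m)] = 0 < mult_χ ℂ[Δ(X₀₀^{m-n} per_n)]`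
is impossible. Fresh-padding twin of `not_isOccurrenceObstructionAt_det_of_bip2019` (BIP's own
padding, threshold `n^25 ≤ m`). [cite: BurgisserIkenmeyerPanovaJAMS2019, Thm. 1.4] -/
theorem not_isOccurrenceObstructionAt_perDet_of_succ_pow_le {n m : ℕ} [NeZero m]
    (hnm : (n + 1) ^ 25 ≤ m) (χ : Weight (MatIdx m)) :
    ¬ IsOccurrenceObstructionAt (detFormLex ℂ m) (paddedPerFormLex ℂ n m) m χ := by
  rintro ⟨hdet, hper⟩
  have hpos := orbitMultiplicity_det_pos_of_paddedPer_pos hnm hper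
  omega

/-! ### 2. What an obstruction beyond the threshold must look like -/

/-- **An obstruction beyond BIP's threshold occurs on the determinant side**: if `χ` is a
multiplicity obstruction at `(n, m)` (`PerDetMultiplicityObstruction`: `n ≤ m`,
`mult_χ ℂ[Δ(det_m)] < mult_χ ℂ[Δ(X₀₀^{m-n} per_n)]`) and `(n+1)^25 ≤ m`, then
`0 < mult_χ ℂ[Δ(det_m)]`. (Whether such `χ` exists for any `m > n ≥ 3` is open,
Bläser–Ikenmeyer 2025 §12.4.) [cite: BurgisserIkenmeyerPanovaJAMS2019, Thm. 1.4 and §1.4] -/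
theorem PerDetMultiplicityObstruction.orbitMultiplicity_det_pos {n m : ℕ} [NeZero m]
    {χ : Weight (MatIdx m)} (h : PerDetMultiplicityObstruction (k := ℂ) n m χ)
    (hnm : (n + 1) ^ 25 ≤ m) : 0 < orbitMultiplicity ℂ (detFormLex ℂ m) m χ :=
  orbitMultiplicity_det_pos_of_paddedPer_pos hnm
    (lt_of_le_of_lt (Nat.zero_le _) (perDetMultiplicityObstruction_iff.mp h).2)

/-- Hence the permanent side of such an obstruction has multiplicity at least `2`: the flip reads
`1 ≤ mult_χ ℂ[Δ(det_m)] < mult_χ ℂ[Δ(X₀₀^{m-n} per_n)]`. [cite: BurgisserIkenmeyerPanovaJAMS2019, Thm. 1.4 and §1.4] -/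
theorem PerDetMultiplicityObstruction.two_le_orbitMultiplicity_paddedPer {n m : ℕ} [NeZero m]
    {χ : Weight (MatIdx m)} (h : PerDetMultiplicityObstruction (k := ℂ) n m χ)
    (hnm : (n + 1) ^ 25 ≤ m) : 2 ≤ orbitMultiplicity ℂ (paddedPerFormLex ℂ n m) m χ := by
  have hdet := h.orbitMultiplicity_det_pos hnm
  have hlt := (perDetMultiplicityObstruction_iff.mp h).2
  omega

/-- Such an obstruction is not an occurrence obstruction. [cite: BurgisserIkenmeyerPanovaJAMS2019, Thm. 1.4] -/
theorem PerDetMultiplicityObstruction.not_isOccurrenceObstructionAt {n m : ℕ} [NeZero m]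
    {χ : Weight (MatIdx m)} (_h : PerDetMultiplicityObstruction (k := ℂ) n m χ)
    (hnm : (n + 1) ^ 25 ≤ m) :
    ¬ IsOccurrenceObstructionAt (detFormLex ℂ m) (paddedPerFormLex ℂ n m) m χ :=
  not_isOccurrenceObstructionAt_perDet_of_succ_pow_le hnm χ

/-- **What remains after BIP, fresh-variable padding, unconditionally.** A multiplicity
obstruction `χ` at `(n, m)` with `(n+1)^25 ≤ m` is a vanishing ideal occurrence obstruction
(`mult_χ ℂ[Δ(det_m)] < mult_χ ℂ[Sym^m] = mult_χ ℂ[Δ(X₀₀^{m-n} per_n)]`) or a pure multiplicity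
obstruction (`0 < mult_det < mult_per < mult_χ ℂ[Sym^m]`), never an occurrence obstruction —
the trichotomy of `ObstructionTypes.lean` with BLMW's bound `orbitMultiplicity_le_plethysmCoeff_holds`
and `not_isOccurrenceObstructionAt_perDet_of_succ_pow_le`. Fresh-padding twin of
`bip2019_remaining_obstruction_types'` (`NoOccurrenceObstructionsWaringRank.lean`). BIP §1.4:
"there still remains the possibility that one may succeed so by comparing multiplicities".
[cite: BurgisserIkenmeyerPanovaJAMS2019, Thm. 1.4 and §1.4] -/
theorem PerDetMultiplicityObstruction.isVanishingIdealOccurrence_or_pure {n m : ℕ} [NeZero m]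
    {χ : Weight (MatIdx m)} (h : PerDetMultiplicityObstruction (k := ℂ) n m χ)
    (hnm : (n + 1) ^ 25 ≤ m) :
    IsVanishingIdealOccurrenceObstructionAt (detFormLex ℂ m) (paddedPerFormLex ℂ n m) m χ ∨
      IsPureMultiplicityObstructionAt (detFormLex ℂ m) (paddedPerFormLex ℂ n m) m χ := by
  obtain ⟨hle, hlt⟩ := perDetMultiplicityObstruction_iff.mp h
  rcases isMultiplicityObstructionAt_trichotomy_of_isHomogeneous
      (f := detFormLex ℂ m) (g := paddedPerFormLex ℂ n m) (χ := χ)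
      orbitMultiplicity_le_plethysmCoeff_holds (NeZero.ne m)
      (paddedPerFormLex_isHomogeneous ℂ hle) hlt with hocc | hrest
  · exact absurd hocc (not_isOccurrenceObstructionAt_perDet_of_succ_pow_le hnm χ)
  · exact hrest

/-- The same census for a multiplicity obstruction given in the typology's own letters
(`IsMultiplicityObstructionAt`, with `n ≤ m` to exclude the junk range of the padding).
[cite: BurgisserIkenmeyerPanovaJAMS2019, Thm. 1.4 and §1.4] -/
theorem isMultiplicityObstructionAt_perDet_remaining_kinds {n m : ℕ} [NeZero m] (hle : n ≤ m)
    (hnm : (n + 1) ^ 25 ≤ m) (χ : Weight (MatIdx m))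
    (h : IsMultiplicityObstructionAt (detFormLex ℂ m) (paddedPerFormLex ℂ n m) m χ) :
    IsVanishingIdealOccurrenceObstructionAt (detFormLex ℂ m) (paddedPerFormLex ℂ n m) m χ ∨
      IsPureMultiplicityObstructionAt (detFormLex ℂ m) (paddedPerFormLex ℂ n m) m χ :=
  PerDetMultiplicityObstruction.isVanishingIdealOccurrence_or_pure
    (perDetMultiplicityObstruction_iff.mpr ⟨hle, h⟩) hnm

/-! ### 3. Polynomial threshold `n ^ 50 ≤ m` (the shape `n ^ c₀ ≤ m` of `GctNoMultBarrier`) -/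

/-- Arithmetic: `(n+1)^25 ≤ n^50` for `2 ≤ n` (as `n + 1 ≤ n·n`), so `n^50 ≤ m` implies BIP's
fresh-padding threshold `(n+1)^25 ≤ m` (private arithmetic helper). [folklore] -/
private theorem succ_pow_le_of_pow_fifty_le {n m : ℕ} (hn : 2 ≤ n) (hm : n ^ 50 ≤ m) : (n + 1) ^ 25 ≤ m :=
  calc (n + 1) ^ 25 ≤ (n * n) ^ 25 := Nat.pow_le_pow_left (by nlinarith) 25
    _ = n ^ 50 := by ring
    _ ≤ m := hm

/-- BIP Thm. 1.4, fresh padding, polynomial threshold: for `2 ≤ n`, `n^50 ≤ m`, positive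
multiplicity on the permanent side forces positive multiplicity on the determinant side.
[cite: BurgisserIkenmeyerPanovaJAMS2019, Thm. 1.4] -/
theorem orbitMultiplicity_det_pos_of_paddedPer_pos_of_pow_fifty_le {n m : ℕ} [NeZero m]
    (hn : 2 ≤ n) (hm : n ^ 50 ≤ m) {χ : Weight (MatIdx m)}
    (h : 0 < orbitMultiplicity ℂ (paddedPerFormLex ℂ n m) m χ) :
    0 < orbitMultiplicity ℂ (detFormLex ℂ m) m χ :=
  orbitMultiplicity_det_pos_of_paddedPer_pos (succ_pow_le_of_pow_fifty_le hn hm) h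

/-- No occurrence obstruction at `(n, m)` for `2 ≤ n`, `n^50 ≤ m` (fresh padding).
[cite: BurgisserIkenmeyerPanovaJAMS2019, Thm. 1.4] -/
theorem not_isOccurrenceObstructionAt_perDet_of_pow_fifty_le {n m : ℕ} [NeZero m] (hn : 2 ≤ n)
    (hm : n ^ 50 ≤ m) (χ : Weight (MatIdx m)) :
    ¬ IsOccurrenceObstructionAt (detFormLex ℂ m) (paddedPerFormLex ℂ n m) m χ :=
  not_isOccurrenceObstructionAt_perDet_of_succ_pow_le (succ_pow_le_of_pow_fifty_le hn hm) χ

/-- **The occurrence shadow of `GctNoMultBarrier`, polynomial form**: with `c₀ = 50`, `n₀ = 2`,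
for all `n ≥ n₀`, all `m` with `n ^ c₀ ≤ m` and every highest weight `χ`,
`min 1 (mult_χ ℂ[Δ(X₀₀^{m-n} per_n)]) ≤ min 1 (mult_χ ℂ[Δ(det_m)])` — literally the body of route
`ValiantsHypothesis/GCTMult`'s open item `GctNoMultBarrier` with both multiplicities truncated at
`1`. [cite: BurgisserIkenmeyerPanovaJAMS2019, Thm. 1.4] -/
theorem exists_threshold_min_one_orbitMultiplicity_paddedPer_le_det :
    ∃ c₀ n₀ : ℕ, ∀ n ≥ n₀, ∀ (m : ℕ) [NeZero m], n ^ c₀ ≤ m → ∀ χ : Weight (MatIdx m),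
      min 1 (orbitMultiplicity ℂ (paddedPerFormLex ℂ n m) m χ) ≤
        min 1 (orbitMultiplicity ℂ (detFormLex ℂ m) m χ) :=
  ⟨50, 2, fun _ hn _ _ hm χ =>
    min_one_orbitMultiplicity_paddedPer_le_det (succ_pow_le_of_pow_fifty_le hn hm) χ⟩

/-! ### 4. The printed threshold `n ^ 25 ≤ m` (`0 < n`) for the fresh-variable padding

The tree also PROVES the fresh-padding statement at BIP's printed threshold `n^25 ≤ m` for
`0 < n` — `Literature.Computability.Complexity.no_occurrence_obstructions_holds` (pnp.S28 discharged,
`OccurrenceObstructionsDischarge.lean`: BIP §6 with `M = n + 1` for `n ≥ 4`, and `Z ⊆ Ω_m` directly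
for `n ≤ 3`). The statements of §§1–2 follow verbatim at that threshold (appended 2026-08-26; the
`(n+1)^25` forms above are kept, being what the route files quote). -/

/-- **BIP Thm. 1.4, fresh padding, printed threshold, multiplicity letters**: for `0 < n`,
`n^25 ≤ m`, positive multiplicity in `ℂ[Δ(X₀₀^{m-n} per_n)]` forces positive multiplicity in
`ℂ[Δ(det_m)]` (tree `no_occurrence_obstructions_holds` through
`orbitMultiplicity_pos_iff_hasHighestWeight`). [cite: BurgisserIkenmeyerPanovaJAMS2019, Thm. 1.4] -/
theorem orbitMultiplicity_det_pos_of_paddedPer_pos_of_pow_le {n m : ℕ} [NeZero m] (hn : 0 < n)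
    (hnm : n ^ 25 ≤ m) {χ : Weight (MatIdx m)}
    (h : 0 < orbitMultiplicity ℂ (paddedPerFormLex ℂ n m) m χ) :
    0 < orbitMultiplicity ℂ (detFormLex ℂ m) m χ := by
  have hper : HasHighestWeight (paddedPerOrbitRep ℂ n m) χ :=
    (orbitMultiplicity_pos_iff_hasHighestWeight (paddedPerFormLex ℂ n m) (NeZero.ne m) χ).1 h
  have hdet : HasHighestWeight (detOrbitRep ℂ m) χ :=
    Complexity.no_occurrence_obstructions_holds n m hn hnm χ hper
  exact (orbitMultiplicity_pos_iff_hasHighestWeight (detFormLex ℂ m) (NeZero.ne m) χ).2 hdet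

/-- No occurrence obstruction against `X₀₀^{m-n} per_n ∈ Δ(det_m)` for `0 < n`, `n^25 ≤ m` (fresh
padding, numeric typology of `ObstructionTypes.lean`). [cite: BurgisserIkenmeyerPanovaJAMS2019, Thm. 1.4] -/
theorem not_isOccurrenceObstructionAt_perDet_of_pow_le {n m : ℕ} [NeZero m] (hn : 0 < n)
    (hnm : n ^ 25 ≤ m) (χ : Weight (MatIdx m)) :
    ¬ IsOccurrenceObstructionAt (detFormLex ℂ m) (paddedPerFormLex ℂ n m) m χ := by
  rintro ⟨hdet, hper⟩
  have hpos := orbitMultiplicity_det_pos_of_paddedPer_pos_of_pow_le hn hnm hper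
  omega

/-- An obstruction at `(n, m)` with `0 < n`, `n^25 ≤ m` occurs on the determinant side:
`0 < mult_χ ℂ[Δ(det_m)]`. [cite: BurgisserIkenmeyerPanovaJAMS2019, Thm. 1.4 and §1.4] -/
theorem PerDetMultiplicityObstruction.orbitMultiplicity_det_pos_of_pow_le {n m : ℕ} [NeZero m]
    {χ : Weight (MatIdx m)} (h : PerDetMultiplicityObstruction (k := ℂ) n m χ) (hn : 0 < n)
    (hnm : n ^ 25 ≤ m) : 0 < orbitMultiplicity ℂ (detFormLex ℂ m) m χ :=
  orbitMultiplicity_det_pos_of_paddedPer_pos_of_pow_le hn hnm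
    (lt_of_le_of_lt (Nat.zero_le _) (perDetMultiplicityObstruction_iff.mp h).2)

/-- Such an obstruction is a vanishing ideal occurrence obstruction or a pure multiplicity
obstruction, never an occurrence obstruction (printed threshold).
[cite: BurgisserIkenmeyerPanovaJAMS2019, Thm. 1.4 and §1.4] -/
theorem PerDetMultiplicityObstruction.isVanishingIdealOccurrence_or_pure_of_pow_le {n m : ℕ}
    [NeZero m] {χ : Weight (MatIdx m)} (h : PerDetMultiplicityObstruction (k := ℂ) n m χ)
    (hn : 0 < n) (hnm : n ^ 25 ≤ m) :
    IsVanishingIdealOccurrenceObstructionAt (detFormLex ℂ m) (paddedPerFormLex ℂ n m) m χ ∨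
      IsPureMultiplicityObstructionAt (detFormLex ℂ m) (paddedPerFormLex ℂ n m) m χ := by
  obtain ⟨hle, hlt⟩ := perDetMultiplicityObstruction_iff.mp h
  rcases isMultiplicityObstructionAt_trichotomy_of_isHomogeneous
      (f := detFormLex ℂ m) (g := paddedPerFormLex ℂ n m) (χ := χ)
      orbitMultiplicity_le_plethysmCoeff_holds (NeZero.ne m)
      (paddedPerFormLex_isHomogeneous ℂ hle) hlt with hocc | hrest
  · exact absurd hocc (not_isOccurrenceObstructionAt_perDet_of_pow_le hn hnm χ)
  · exact hrest

/-- **The occurrence shadow of `GctNoMultBarrier` at the printed exponent**: with `c₀ = 25`,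
`n₀ = 1`, for all `n ≥ n₀`, all `m` with `n ^ c₀ ≤ m` and every `χ`,
`min 1 (mult_χ ℂ[Δ(X₀₀^{m-n} per_n)]) ≤ min 1 (mult_χ ℂ[Δ(det_m)])`.
[cite: BurgisserIkenmeyerPanovaJAMS2019, Thm. 1.4] -/
theorem exists_threshold_min_one_orbitMultiplicity_paddedPer_le_det' :
    ∃ c₀ n₀ : ℕ, ∀ n ≥ n₀, ∀ (m : ℕ) [NeZero m], n ^ c₀ ≤ m → ∀ χ : Weight (MatIdx m),
      min 1 (orbitMultiplicity ℂ (paddedPerFormLex ℂ n m) m χ) ≤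
        min 1 (orbitMultiplicity ℂ (detFormLex ℂ m) m χ) := by
  refine ⟨25, 1, fun n hn m _ hm χ => ?_⟩
  rcases Nat.eq_zero_or_pos (orbitMultiplicity ℂ (paddedPerFormLex ℂ n m) m χ) with h0 | hpos
  · rw [h0]
    exact (Nat.min_eq_right (Nat.zero_le 1)).le.trans (Nat.zero_le _)
  · have hdet := orbitMultiplicity_det_pos_of_paddedPer_pos_of_pow_le hn hm hpos
    omega

/-! ### A numeric flip is a module-form multiplicity obstruction (`HasMultiplicityObstruction`) -/

/-- Renaming along `toLex` does not change the module-form multiplicity-obstruction predicate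
(`MatIdx m` is a type synonym of `Fin m × Fin m` and `toLex` the identity: same `GL`, same
coordinate rings, same gradings) — the multiplicity twin of
`Literature.Computability.Complexity.hasOccurrenceObstruction_rename_toLex_iff`. [folklore] -/
private theorem hasMultiplicityObstruction_rename_toLex_iff {k : Type} [Field k] {m : ℕ}
    (f g : MvPolynomial (Fin m × Fin m) k) (M d : ℕ) :
    HasMultiplicityObstruction (σ := MatIdx m) (MvPolynomial.rename toLex f)
      (MvPolynomial.rename toLex g) M d ↔
      HasMultiplicityObstruction f g M d := by
  have hf : (MvPolynomial.rename toLex f : MvPolynomial (MatIdx m) k) = f :=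
    MvPolynomial.rename_id_apply f
  have hg : (MvPolynomial.rename toLex g : MvPolynomial (MatIdx m) k) = g :=
    MvPolynomial.rename_id_apply g
  rw [hf, hg]
  exact Iff.rfl

/-- **A multiplicity obstruction in the cell's numeric letters is one in the module form of
`GCTObstructions.lean`.** Characteristic zero: if `PerDetMultiplicityObstruction n m χ` (`n ≤ m` and
`mult_χ k[Δ(det_m)] < mult_χ k[Δ(X₀₀^{m-n} per_n)]`), then for the degree `d` pinned by the weight
(`|χ| = -m·d`) there is NO surjective `GL_{m²}`-intertwiner `k[Δ(det_m)]_d ↠ k[Δ(X₀₀^{m-n} per_n)]_d`,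
i.e. `HasMultiplicityObstruction (detPoly (Fin m) k) (paddedPerPoly k n m) m d` — the shape of the crux
`GctMultObstructions` of route `ValiantsHypothesis/GCTMult` (variables `Fin m × Fin m`; the statement
for the lexicographic copy `detFormLex` / `paddedPerFormLex` is
`exists_hasMultiplicityObstruction_of_isMultiplicityObstructionAt` itself). A surjection would bound
`mult_χ` of the target by that of the completely reducible source (Bläser–Ikenmeyer Cor. 12.6, tree
`hwMultiplicity_le_of_surjective`). Bläser–Ikenmeyer §12.4 ("Such `λ` are called representation
theoretic multiplicity obstructions"); BIP §1(a).
[cite: BlaeserIkenmeyer2025, §12.4 (multiplicity obstructions) with Cor. 12.6] -/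
theorem PerDetMultiplicityObstruction.exists_hasMultiplicityObstruction {k : Type} [Field k]
    [CharZero k] {n m : ℕ} [NeZero m] {χ : Weight (MatIdx m)}
    (h : PerDetMultiplicityObstruction (k := k) n m χ) :
    ∃ d : ℕ, χ.size = -((m * d : ℕ) : ℤ) ∧
      HasMultiplicityObstruction (detPoly (Fin m) k) (paddedPerPoly k n m) m d := by
  obtain ⟨-, hlt⟩ := perDetMultiplicityObstruction_iff.mp h
  obtain ⟨d, hd, hobs⟩ := exists_hasMultiplicityObstruction_of_isMultiplicityObstructionAt
    (f := detFormLex k m) (g := paddedPerFormLex k n m) (NeZero.ne m) hlt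
  exact ⟨d, hd, (hasMultiplicityObstruction_rename_toLex_iff (detPoly (Fin m) k)
    (paddedPerPoly k n m) m d).mp hobs⟩

end Literature.Computability.AlgebraicComplexity
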